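import Literature.Analysis.SpecialFunctions.DigammaGauss
import HarnessLib

/-!
# Format D-K soundness, part 2: the digamma function on vertical lines `Re w = x > 0`

Cell `rh-explicit`, WEIL TRACK — GRH ARM, route B (weil-grh-3).  The archimedean weight of the twisted
Weil form is `τ ↦ Re ψ(1/4 + a/2 + iτ/2)` (`a` = parity); the kernel checker `DualTrigKernel.lean`
needs, for `x = 1/4` AND `x = 3/4`:

* the vertical series (Andrews–Askey–Roy (1.2.13) at `w = x + iy` minus the same at `w = x`)
  `Re ψ(x + iy) − Re ψ(x) = Σ_{m ≥ 0} f_{m+x}(y)`, `f_l(y) = y²/(l(l² + y²))` (`hasSum_vterm`);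
* the BRACKET `BR_M(y) = Re ψ(x+iy) − Σ_{m<M} f_{m+x}(y)` (the series with its first `M` terms removed)
  is even and increasing in `|y|` (`bracket_mono`), so that on a cell it is bounded below by its value
  at the point nearest to `0` — in particular (`M = 0`) `Re ψ(x+iy)` itself is monotone in `|y|`;
* the first-order expansion of one term with an ALGEBRAIC remainder:
  `f_l(y) ≥ f_l(c) + f_l'(c)(y − c) − (y − c)² (l² + c² + 2|c||y|)/(l(l²+c²)²)` (`vterm_taylor_lower`),
  from the identity `f_l(y) − f_l(c) − f_l'(c)(y−c) = l(y−c)²(l² − c² − 2cy)/((l²+c²)²(l²+y²))`.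

The `x = 1/4` case of the series is the tree's `hasSum_digammaTerm` (`DigammaVerticalSeries.lean`);
here `x > 0` is arbitrary.  Everything is PROVED; no named facts, no `sorry`.

## References

* G. E. Andrews, R. Askey, R. Roy, *Special Functions*, CUP 1999, Thm. 1.2.5 (1.2.13)
  (`hasSum_one_div_sub_one_div_digamma` of the tree). [folklore]
* H. Yoshida, Adv. Stud. Pure Math. 21 (1992), §6, p. 309 (monotonicity of `Re ψ(σ + it)` in `t`).
-/

noncomputable section

open Complex Finset Filter Topology

namespace Summit.Ventures.WeilGRH

namespace DigammaVertical

/-- The term `f_l(y) = y²/(l(l² + y²))` of the vertical series. [folklore] -/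
def vterm (l y : ℝ) : ℝ := y ^ 2 / (l * (l ^ 2 + y ^ 2))

/-- `f_l(y) ≥ 0` for `l > 0`. [folklore] -/
theorem vterm_nonneg {l : ℝ} (hl : 0 < l) (y : ℝ) : 0 ≤ vterm l y := by
  unfold vterm; positivity

/-- `f_l` is even. [folklore] -/
theorem vterm_neg (l y : ℝ) : vterm l (-y) = vterm l y := by simp [vterm]

/-- `f_l(y) = 1/l − l/(l² + y²)`. [folklore] -/
theorem vterm_eq {l : ℝ} (hl : 0 < l) (y : ℝ) : vterm l y = 1 / l - l / (l ^ 2 + y ^ 2) := by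
  unfold vterm
  have h1 : 0 < l ^ 2 + y ^ 2 := by positivity
  field_simp
  ring

/-- `f_l` is increasing in `|y|`. [folklore] -/
theorem vterm_mono {l : ℝ} (hl : 0 < l) {y u : ℝ} (h : |u| ≤ |y|) : vterm l u ≤ vterm l y := by
  rw [vterm_eq hl, vterm_eq hl]
  have hsq : u ^ 2 ≤ y ^ 2 := by simpa only [sq_abs] using pow_le_pow_left₀ (abs_nonneg u) h 2
  have h1 : 0 < l ^ 2 + u ^ 2 := by positivity
  have h2 : l / (l ^ 2 + y ^ 2) ≤ l / (l ^ 2 + u ^ 2) :=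
    div_le_div_of_nonneg_left hl.le h1 (by linarith)
  linarith

/-- Real part of `1/(x + iy + k)`. [folklore] -/
theorem re_one_div (x y : ℝ) (k : ℕ) :
    (1 / ((x : ℂ) + y * I + k)).re = (x + k) / ((x + k) ^ 2 + y ^ 2) := by
  have h := Literature.Analysis.SpecialFunctions.Complex.re_one_div_add_ofReal ((x : ℂ) + y * I) (k : ℝ)
  have hre : ((x : ℂ) + y * I).re = x := by simp
  have him : ((x : ℂ) + y * I).im = y := by simp
  rw [hre, him] at h
  have hk : ((k : ℝ) : ℂ) = (k : ℂ) := by norm_cast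
  rw [hk] at h
  rw [h]

variable {x : ℝ}

/-- **The vertical series**: for `x > 0`, `Σ_{m≥0} f_{m+x}(y) = Re ψ(x + iy) − Re ψ(x)`.
[cite: AndrewsAskeyRoy1999, Thm 1.2.5 (1.2.13)] -/
theorem hasSum_vterm (hx : 0 < x) (y : ℝ) :
    HasSum (fun m : ℕ ↦ vterm ((m : ℝ) + x) y)
      ((digamma ((x : ℂ) + y * I)).re - (digamma (x : ℂ)).re) := by
  set w : ℂ := (x : ℂ) + y * I with hw_def
  have hw : 0 < w.re := by simp [hw_def, hx]
  have hw0 : 0 < ((x : ℂ) + (0 : ℝ) * I).re := by simp [hx]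
  have h1 := Literature.Analysis.SpecialFunctions.Complex.hasSum_one_div_sub_one_div_digamma hw
  have h0 := Literature.Analysis.SpecialFunctions.Complex.hasSum_one_div_sub_one_div_digamma hw0
  have h := (h1.sub h0).mapL Complex.reCLM
  simp only [Complex.reCLM_apply] at h
  have e0 : ((x : ℂ) + (0 : ℝ) * I) = (x : ℂ) := by simp
  have hlim : (digamma w + Real.eulerMascheroniConstant -
      (digamma ((x : ℂ) + (0 : ℝ) * I) + Real.eulerMascheroniConstant)).re =
      (digamma ((x : ℂ) + y * I)).re - (digamma (x : ℂ)).re := by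
    rw [e0, hw_def]; simp only [sub_re, add_re]; ring
  rw [hlim] at h
  refine h.congr_fun fun k ↦ ?_
  symm
  change (1 / ((k : ℂ) + 1) - 1 / (w + k) - (1 / ((k : ℂ) + 1) - 1 / ((x : ℂ) + (0 : ℝ) * I + k))).re
    = vterm ((k : ℝ) + x) y
  have e1 : (1 / ((k : ℂ) + 1) - 1 / (w + k) - (1 / ((k : ℂ) + 1) - 1 / ((x : ℂ) + (0 : ℝ) * I + k))) =
      1 / ((x : ℂ) + (0 : ℝ) * I + k) - 1 / (w + k) := by ring
  rw [e1, sub_re, hw_def, re_one_div, re_one_div]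
  unfold vterm
  have ha : (0 : ℝ) < x + k := by positivity
  have hb : (0 : ℝ) < (x + k) ^ 2 + y ^ 2 := by positivity
  field_simp
  ring

/-- Summability of the vertical series. [folklore] -/
theorem summable_vterm (hx : 0 < x) (y : ℝ) : Summable fun m : ℕ ↦ vterm ((m : ℝ) + x) y :=
  (hasSum_vterm hx y).summable

/-- The BRACKET: `Re ψ(x + iy)` with the first `M` series terms removed. [folklore] -/
def bracket (x : ℝ) (M : ℕ) (y : ℝ) : ℝ :=
  (digamma ((x : ℂ) + y * I)).re - ∑ m ∈ range M, vterm ((m : ℝ) + x) y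

/-- The bracket is `Re ψ(x)` plus the tail of the series. [folklore] -/
theorem hasSum_bracket (hx : 0 < x) (M : ℕ) (y : ℝ) :
    HasSum (fun m : ℕ ↦ vterm ((m : ℝ) + M + x) y) (bracket x M y - (digamma (x : ℂ)).re) := by
  have h := (hasSum_nat_add_iff' (f := fun m : ℕ ↦ vterm ((m : ℝ) + x) y) M).2 (hasSum_vterm hx y)
  have e : (fun m : ℕ ↦ vterm ((m : ℝ) + M + x) y) = fun n : ℕ ↦ vterm (((n + M : ℕ) : ℝ) + x) y := by
    funext m; push_cast; rfl
  rw [e]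
  have e2 : bracket x M y - (digamma (x : ℂ)).re =
      (digamma ((x : ℂ) + y * I)).re - (digamma (x : ℂ)).re - ∑ i ∈ range M, vterm ((i : ℝ) + x) y := by
    unfold bracket; ring
  rw [e2]
  exact h

/-- **Monotonicity of the bracket in `|y|`** (each remaining term is even and increasing in `|y|`).
[cite: Yoshida1992, §6 (p. 309)] -/
theorem bracket_mono (hx : 0 < x) (M : ℕ) {y u : ℝ} (h : |u| ≤ |y|) :
    bracket x M u ≤ bracket x M y := by
  have hu := hasSum_bracket hx M u
  have hy := hasSum_bracket hx M y
  have := hasSum_le (fun m ↦ vterm_mono (by positivity) h) hu hy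
  linarith

/-- The bracket is even in `y`. [folklore] -/
theorem bracket_neg (hx : 0 < x) (M : ℕ) (y : ℝ) : bracket x M (-y) = bracket x M y :=
  le_antisymm (bracket_mono hx M (by simp)) (bracket_mono hx M (by simp))

/-- `Re ψ(x + iy)` is increasing in `|y|` (`M = 0`). [cite: Yoshida1992, §6 (p. 309)] -/
theorem re_digamma_mono (hx : 0 < x) {y u : ℝ} (h : |u| ≤ |y|) :
    (digamma ((x : ℂ) + u * I)).re ≤ (digamma ((x : ℂ) + y * I)).re := by
  simpa [bracket] using bracket_mono hx 0 h

/-- `Re ψ(x + iy)` from the bracket: `Re ψ(x+iy) = BR_M(y) + Σ_{m<M} f_{m+x}(y)`. [folklore] -/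
theorem re_digamma_eq_bracket_add (x : ℝ) (M : ℕ) (y : ℝ) :
    (digamma ((x : ℂ) + y * I)).re = bracket x M y + ∑ m ∈ range M, vterm ((m : ℝ) + x) y := by
  simp [bracket]

/-! ### First-order expansion of one term with algebraic remainder -/

/-- The derivative value `f_l'(c) = 2lc/(l² + c²)²`. [folklore] -/
def vtermD (l c : ℝ) : ℝ := 2 * l * c / (l ^ 2 + c ^ 2) ^ 2

/-- The remainder identity `f(y) − f(c) − f'(c)(y − c) = l(y−c)²(l² − c² − 2cy)/((l²+c²)²(l²+y²))`.
[folklore] -/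
theorem vterm_sub_sub (l : ℝ) (hl : 0 < l) (y c : ℝ) :
    vterm l y - vterm l c - vtermD l c * (y - c) =
      l * (y - c) ^ 2 * (l ^ 2 - c ^ 2 - 2 * c * y) / ((l ^ 2 + c ^ 2) ^ 2 * (l ^ 2 + y ^ 2)) := by
  rw [vterm_eq hl, vterm_eq hl, vtermD]
  have h1 : 0 < l ^ 2 + y ^ 2 := by positivity
  have h2 : 0 < l ^ 2 + c ^ 2 := by positivity
  field_simp
  ring

/-- **First-order lower bound with algebraic remainder**: for `l > 0` and `|y| ≤ Y`,
`f_l(y) ≥ f_l(c) + f_l'(c)(y − c) − (y−c)² (l² + c² + 2|c|Y)/(l(l²+c²)²)`. [folklore] -/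
theorem vterm_taylor_lower {l : ℝ} (hl : 0 < l) {y Y : ℝ} (hY : |y| ≤ Y) (c : ℝ) :
    vterm l c + vtermD l c * (y - c) - (y - c) ^ 2 * ((l ^ 2 + c ^ 2 + 2 * |c| * Y) / (l * (l ^ 2 + c ^ 2) ^ 2))
      ≤ vterm l y := by
  have hid := vterm_sub_sub l hl y c
  have h1 : 0 < l ^ 2 + y ^ 2 := by positivity
  have h2 : 0 < l ^ 2 + c ^ 2 := by positivity
  -- bound the remainder in absolute value
  have hnum : |l ^ 2 - c ^ 2 - 2 * c * y| ≤ l ^ 2 + c ^ 2 + 2 * |c| * Y := by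
    have h3 : |2 * c * y| = 2 * |c| * |y| := by
      rw [abs_mul, abs_mul]; simp
    have h4 : |l ^ 2 - c ^ 2| ≤ l ^ 2 + c ^ 2 :=
      (abs_sub _ _).trans (by rw [abs_of_nonneg (sq_nonneg l), abs_of_nonneg (sq_nonneg c)])
    have h5 : |2 * c * y| ≤ 2 * |c| * Y := by
      rw [h3]; exact mul_le_mul_of_nonneg_left hY (by positivity)
    exact (abs_sub _ _).trans (add_le_add h4 h5)
  have hR : |l * (y - c) ^ 2 * (l ^ 2 - c ^ 2 - 2 * c * y) / ((l ^ 2 + c ^ 2) ^ 2 * (l ^ 2 + y ^ 2))|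
      ≤ (y - c) ^ 2 * ((l ^ 2 + c ^ 2 + 2 * |c| * Y) / (l * (l ^ 2 + c ^ 2) ^ 2)) := by
    rw [abs_div, abs_of_pos (by positivity : (0 : ℝ) < (l ^ 2 + c ^ 2) ^ 2 * (l ^ 2 + y ^ 2)),
      abs_mul, abs_mul, abs_of_pos hl, abs_of_nonneg (sq_nonneg (y - c))]
    rw [div_le_iff₀ (by positivity)]
    have hl2 : l * l ≤ l ^ 2 + y ^ 2 := by nlinarith [sq_nonneg y]
    calc l * (y - c) ^ 2 * |l ^ 2 - c ^ 2 - 2 * c * y|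
        ≤ l * (y - c) ^ 2 * (l ^ 2 + c ^ 2 + 2 * |c| * Y) := by gcongr
      _ = (y - c) ^ 2 * ((l ^ 2 + c ^ 2 + 2 * |c| * Y) / (l * (l ^ 2 + c ^ 2) ^ 2)) *
            ((l ^ 2 + c ^ 2) ^ 2 * (l * l)) := by
          field_simp
      _ ≤ (y - c) ^ 2 * ((l ^ 2 + c ^ 2 + 2 * |c| * Y) / (l * (l ^ 2 + c ^ 2) ^ 2)) *
            ((l ^ 2 + c ^ 2) ^ 2 * (l ^ 2 + y ^ 2)) := by
          have hc : 0 ≤ 2 * |c| * Y := by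
            have : 0 ≤ Y := (abs_nonneg y).trans hY
            positivity
          gcongr
  rw [abs_le] at hR
  linarith [hR.1]

end DigammaVertical

end Summit.Ventures.WeilGRH

end
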